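import Mathlib
import Summits.Ventures.HodgeRepro2.T5N2DatumExistence
import Summits.Ventures.HodgeRepro2.CyclotomicSeven
import Summits.Ventures.HodgeRepro2.T6N2Main
import Summits.Ventures.HodgeRepro2.T6NAut2
import Summits.Ventures.HodgeRepro2.T6N2WeakApprox

/-!
# T6N2ToyIso — an N2 datum with an EXPLICIT isometry: `Adm` with no hypothesis (README §10.5(ii)(d);
owner t6-p5)

T6N2Toy's datum satisfies `Adm` modulo the one display (Landherr's classification for `K`, a
statement about all rank-2 forms over `K`). This file exhibits, on every CM frame `τ` of `K` (hence
on every degree-6 CM field, and on `ℚ(ζ₇)`), a datum on which `Adm` holds OUTRIGHT — the isometry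
`W_B ≅ W_A` is written down. The trick: take `e₁₁₁` μ-admissible for the vertex type `111` (p3's
`exists_signElements_of_isCMFrame`, p402183) and a totally real `u` with `τ₁(u) ∈ (0, 1)`,
`τ₂(u) < 0`, `τ₃(u) > 1` (`MagSpec`; WEAK APPROXIMATION WITH MAGNITUDES — Mathlib's
`NumberField.InfinitePlace.denseRange_algebraMap_pi`, `exists_approx` / `exists_u`), and put
`e₁₀₀ := u (1 − u) e₁₁₁`: it is μ-admissible for `100` (`u(1 − u)` is positive exactly at the two
embeddings above the first real place, `pos_re_u_mul_one_sub_iff`, and p3's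
`isLiuSignElement_mul_of_sign`), `u` has the sign pattern `(+, −, +)` (`uSpec_of_magSpec`), and
the two rank-2 forms `W_A = ⟨e₁₁₁, u(1−u) e₁₁₁⟩`, `W_B = ⟨u e₁₁₁, (1−u) e₁₁₁⟩` are isometric
through `g (x, y) = (x + (1 − u) y, x − u y)` (`gEquiv`, `det g = −1`; the vector `(1, 1)` has norm
`u + (1 − u) = 1` in `⟨u, 1 − u⟩` and its orthogonal complement `(1 − u, −u)` has norm `u(1 − u)`),
a finite computation (`formB_gEquiv`: `ring` after conjugating). So `adm_of_explicit` gives `Adm`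
for every datum of this shape with NO display, `toyIso_adm : (toyIso F P 𝒟 hfr).Adm` has no
hypothesis, `ofNAut_toyIso_admDatum` puts it on the M2 carrier (`(NAut2.ofNAut M₁ (toyIso …)).AdmDatum`
for EVERY v1 carrier `M₁` — the binder `hN2` of the lead's `periodInputN_of_mains₂` on the v2 toy is
joint with the others with nothing left over), `N2_main_explicit` is the M2 wrapper
without the display for every carrier whose datum has this shape (the datum is the record's own
construction, so this choice is open to Layer III), and `toyIso6_adm` / `toyIsoF_adm` / `toyIsoK7_adm` instantiate
it on any degree-6 CM field (p3's `exists_muAdmissible_frame`), on any face setting (its `deg6`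
field; `ofNAut_toyIsoF_admDatum`: the N2 block on any v1 carrier with no binder at all) and on
`K7 = ℚ(ζ₇)`.

The toy's admissible sets are `Set.univ`, so t6-p3's interface sentences on the N2 datum —
`N2Datum.AdmSpanning` (T6N3Adm) and the agreed, weaker `N2Datum.AdmGenerating` (T6N3Main2 §1: the
vertex forms of the admissible data generate the vertex forms, TIER4 Lemma A7.3(b); the binder
`hAdm` of `N3iso_main₂` on the M2 v4 line) — hold on it outright (T6N2ToyJoint `d2_admSpanning` /
`d2_admGenerating`). v2 = v1 (p403194) + this paragraph; every declaration byte-identical.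

README §8(d): uses an L-value-free non-vanishing device: NO (TIER5 §N2, a pre-02:16Z line of
record — N2 asserts no non-vanishing — continued).
-/

namespace Summit.Ventures.HodgeRepro2.T6.N2ToyIso

open Summit.Ventures.HodgeRepro2
open Summit.Ventures.HodgeRepro2.T5DatumSimilitude
open Summit.Ventures.HodgeRepro2.T5CubeTypes
open Summit.Ventures.HodgeRepro2.T5DatumCMField hiding star_inv_of_star_eq
open NumberField
open NumberField.ComplexEmbedding (conjugate)
open Summit.Ventures.HodgeRepro2.T6.N2WeakApprox

variable {K : Type*} [Field K] [NumberField K] [NumberField.IsCMField K]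

/-! ### Conjugate embeddings -/

omit [NumberField K] [NumberField.IsCMField K] in
/-- Conjugation of embeddings is injective. -/
theorem conjugate_inj {φ ψ : K →+* ℂ} (h : conjugate φ = conjugate ψ) : φ = ψ := by
  have h' := congrArg conjugate h
  rwa [conjugate_conjugate, conjugate_conjugate] at h'

/-! ### The magnitude specification of `u` and the sign pattern of `u (1 − u)` -/

/-- The MAGNITUDE specification of the similitude scalar: `u` totally real with `τ₁(u) ∈ (0, 1)`,
`τ₂(u) < 0`, `τ₃(u) > 1` (it implies the sign specification `(+, −, +)` of `USpec`). -/
def MagSpec (τ : Fin 3 → (K →+* ℂ)) (u : K) : Prop :=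
  star u = u ∧ 0 < (τ 0 u).re ∧ (τ 0 u).re < 1 ∧ (τ 1 u).re < 0 ∧ 1 < (τ 2 u).re

/-- `exists_u` delivers `MagSpec`. -/
theorem exists_magSpec {τ : Fin 3 → (K →+* ℂ)} (hfr : IsCMFrame τ) : ∃ u : K, MagSpec τ u :=
  exists_u hfr

/-- `Re φ(u(1 − u)) = Re φ(u) · (1 − Re φ(u))` for totally real `u`. -/
theorem re_u_mul_one_sub {u : K} (hu : star u = u) (φ : K →+* ℂ) :
    (φ (u * (1 - u))).re = (φ u).re * (1 - (φ u).re) := by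
  rw [N2Main.re_mul_of_star_eq hu (by rw [star_sub, star_one, hu]) φ, map_sub, map_one,
    Complex.sub_re, Complex.one_re]

/-- `u ≠ 0` under `MagSpec`. -/
theorem ne_zero_of_magSpec {τ : Fin 3 → (K →+* ℂ)} {u : K} (hm : MagSpec τ u) : u ≠ 0 := by
  rintro rfl
  have := hm.2.1
  simp at this

/-- `1 − u ≠ 0` under `MagSpec`. -/
theorem one_sub_ne_zero_of_magSpec {τ : Fin 3 → (K →+* ℂ)} {u : K} (hm : MagSpec τ u) :
    1 - u ≠ 0 := by
  intro h
  have h1 : u = 1 := by linear_combination -h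
  have := hm.2.2.1
  rw [h1, map_one, Complex.one_re] at this
  exact lt_irrefl _ this

/-- `u(1 − u)` is totally real. -/
theorem star_u_mul_one_sub {u : K} (hu : star u = u) : star (u * (1 - u)) = u * (1 - u) := by
  rw [star_mul, star_sub, star_one, hu, mul_comm]

/-- THE SIGN PATTERN OF `u(1 − u)`: positive exactly at the two embeddings above the first real
place — i.e. exactly where the vertex types `111` and `100` agree. -/
theorem pos_re_u_mul_one_sub_iff {τ : Fin 3 → (K →+* ℂ)} (hfr : IsCMFrame τ) {u : K}
    (hm : MagSpec τ u) (φ : K →+* ℂ) :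
    0 < (φ (u * (1 - u))).re ↔
      (φ ∈ T5CubeTypes.cubeType τ t111 ↔ φ ∈ T5CubeTypes.cubeType τ t100) := by
  obtain ⟨hu, h0, h1, h2, h3⟩ := hm
  rw [re_u_mul_one_sub hu]
  obtain ⟨ν, rfl | rfl⟩ := hfr.exhaustive φ
  · rw [apply_mem_cubeType_iff hfr, apply_mem_cubeType_iff hfr]
    match ν with
    | 0 => exact ⟨fun _ => by decide, fun _ => mul_pos h0 (by linarith)⟩
    | 1 => exact ⟨fun h => absurd h (by nlinarith), fun h => absurd h (by decide)⟩
    | 2 => exact ⟨fun h => absurd h (by nlinarith), fun h => absurd h (by decide)⟩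
  · rw [conjugate_apply_mem_cubeType_iff hfr, conjugate_apply_mem_cubeType_iff hfr, re_conjugate]
    match ν with
    | 0 => exact ⟨fun _ => by decide, fun _ => mul_pos h0 (by linarith)⟩
    | 1 => exact ⟨fun h => absurd h (by nlinarith), fun h => absurd h (by decide)⟩
    | 2 => exact ⟨fun h => absurd h (by nlinarith), fun h => absurd h (by decide)⟩

/-- `MagSpec` implies the sign specification `USpec` of the datum. -/
theorem uSpec_of_magSpec {F : FaceSetting K} {P : NDatum F} {𝒟 : N3Datum} (D : N2Datum F P 𝒟)
    (hfr : IsCMFrame D.τ) (hm : MagSpec D.τ D.u) : N2Main.USpec D := by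
  have hu0 := ne_zero_of_magSpec hm
  obtain ⟨hu, h0, h1, h2, h3⟩ := hm
  refine ⟨hu, hu0, fun φ => ?_⟩
  obtain ⟨ν, rfl | rfl⟩ := hfr.exhaustive φ
  · match ν with
    | 0 =>
      refine ⟨fun h => absurd h (not_lt.mpr h0.le), ?_⟩
      rintro (h | h)
      · exact absurd (hfr.injective h) (by decide)
      · exact absurd h (hfr.ne_conjugate _ _)
    | 1 => exact ⟨fun _ => Or.inl rfl, fun _ => h2⟩
    | 2 =>
      refine ⟨fun h => absurd h (not_lt.mpr (by linarith)), ?_⟩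
      rintro (h | h)
      · exact absurd (hfr.injective h) (by decide)
      · exact absurd h (hfr.ne_conjugate _ _)
  · rw [re_conjugate]
    match ν with
    | 0 =>
      refine ⟨fun h => absurd h (not_lt.mpr h0.le), ?_⟩
      rintro (h | h)
      · exact absurd h.symm (hfr.ne_conjugate _ _)
      · exact absurd (hfr.injective (conjugate_inj h)) (by decide)
    | 1 => exact ⟨fun _ => Or.inr rfl, fun _ => h2⟩
    | 2 =>
      refine ⟨fun h => absurd h (not_lt.mpr (by linarith)), ?_⟩
      rintro (h | h)
      · exact absurd h.symm (hfr.ne_conjugate _ _)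
      · exact absurd (hfr.injective (conjugate_inj h)) (by decide)

/-! ### The explicit isometry `g(x, y) = (x + (1 − u) y, x − u y)` -/

omit [NumberField K] [NumberField.IsCMField K] in
/-- `g(x, y) = (x + (1 − u) y, x − u y)` as a `K`-linear map. -/
def gMap (u : K) : (K × K) →ₗ[K] (K × K) where
  toFun v := (v.1 + (1 - u) * v.2, v.1 - u * v.2)
  map_add' v w := by
    ext <;> simp only [Prod.fst_add, Prod.snd_add] <;> ring
  map_smul' c v := by
    ext <;> simp only [Prod.smul_fst, Prod.smul_snd, smul_eq_mul, RingHom.id_apply] <;> ring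

omit [NumberField K] [NumberField.IsCMField K] in
/-- The inverse `(x, y) ↦ (u x + (1 − u) y, x − y)` (`det g = −1`). -/
def gInv (u : K) : (K × K) →ₗ[K] (K × K) where
  toFun v := (u * v.1 + (1 - u) * v.2, v.1 - v.2)
  map_add' v w := by
    ext <;> simp only [Prod.fst_add, Prod.snd_add] <;> ring
  map_smul' c v := by
    ext <;> simp only [Prod.smul_fst, Prod.smul_snd, smul_eq_mul, RingHom.id_apply] <;> ring

omit [NumberField K] [NumberField.IsCMField K] in
/-- `g` as a `K`-linear automorphism of `K × K`. -/
def gEquiv (u : K) : (K × K) ≃ₗ[K] (K × K) :=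
  LinearEquiv.ofLinear (gMap u) (gInv u)
    (LinearMap.ext fun v => Prod.ext
      (by simp only [LinearMap.comp_apply, LinearMap.id_apply, gMap, gInv, LinearMap.coe_mk,
            AddHom.coe_mk]; ring)
      (by simp only [LinearMap.comp_apply, LinearMap.id_apply, gMap, gInv, LinearMap.coe_mk,
            AddHom.coe_mk]; ring))
    (LinearMap.ext fun v => Prod.ext
      (by simp only [LinearMap.comp_apply, LinearMap.id_apply, gMap, gInv, LinearMap.coe_mk,
            AddHom.coe_mk]; ring)
      (by simp only [LinearMap.comp_apply, LinearMap.id_apply, gMap, gInv, LinearMap.coe_mk,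
            AddHom.coe_mk]; ring))

omit [NumberField K] [NumberField.IsCMField K] in
/-- `gEquiv u (x, y) = (x + (1 − u) y, x − u y)`. -/
theorem gEquiv_apply (u : K) (v : K × K) :
    gEquiv u v = (v.1 + (1 - u) * v.2, v.1 - u * v.2) := rfl

omit [NumberField.IsCMField K] in
/-- `e₁₁₀ = (1 − u) e₁₁₁` when `e₁₀₀ = u (1 − u) e₁₁₁`. -/
theorem e₁₁₀_eq {F : FaceSetting K} {P : NDatum F} {𝒟 : N3Datum} (D : N2Datum F P 𝒟)
    (hu0 : D.u ≠ 0) (he : D.e₁₀₀ = D.u * (1 - D.u) * D.e₁₁₁) :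
    D.e₁₁₀ = (1 - D.u) * D.e₁₁₁ := by
  rw [N2Datum.e₁₁₀, he, ← mul_assoc, ← mul_assoc, inv_mul_cancel₀ hu0, one_mul]

/-- THE ISOMETRY, A FINITE COMPUTATION: `W_B(g v, g w) = W_A(v, w)` for
`W_A = ⟨e₁₁₁, u(1−u) e₁₁₁⟩`, `W_B = ⟨u e₁₁₁, (1−u) e₁₁₁⟩`, `g(x, y) = (x + (1 − u) y, x − u y)`. -/
theorem formB_gEquiv {F : FaceSetting K} {P : NDatum F} {𝒟 : N3Datum} (D : N2Datum F P 𝒟)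
    (hu : star D.u = D.u) (hu0 : D.u ≠ 0) (he : D.e₁₀₀ = D.u * (1 - D.u) * D.e₁₁₁)
    (v w : K × K) : D.formB (gEquiv D.u v) (gEquiv D.u w) = D.formA v w := by
  have hs : star (1 - D.u) = 1 - D.u := by rw [star_sub, star_one, hu]
  simp only [N2Datum.formB, N2Datum.formA, N2Datum.e₁₀₁, e₁₁₀_eq D hu0 he, he, pairForm, lineForm,
    gEquiv_apply, star_add, star_sub, star_mul, hs, hu]
  ring

/-- (b2) OUTRIGHT: `W_B ≅ W_A` for the explicit datum — no display. -/
theorem isIsometric_of_explicit {F : FaceSetting K} {P : NDatum F} {𝒟 : N3Datum}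
    (D : N2Datum F P 𝒟) (hu : star D.u = D.u) (hu0 : D.u ≠ 0)
    (he : D.e₁₀₀ = D.u * (1 - D.u) * D.e₁₁₁) : D.IsIsometric :=
  ⟨gEquiv D.u, formB_gEquiv D hu hu0 he⟩

/-! ### `Adm` with no hypothesis -/

/-- `e₁₀₀ = u(1 − u) e₁₁₁` is μ-admissible for the vertex type `100` when `e₁₁₁` is for `111`
and `u` has the magnitudes of `MagSpec`. -/
theorem isLiuSignElement_e₁₀₀_of_explicit {F : FaceSetting K} {P : NDatum F} {𝒟 : N3Datum}
    (D : N2Datum F P 𝒟) (hfr : IsCMFrame D.τ)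
    (h₁₁₁ : IsLiuSignElement K (D.type t111) D.e₁₁₁) (hm : MagSpec D.τ D.u)
    (he : D.e₁₀₀ = D.u * (1 - D.u) * D.e₁₁₁) :
    IsLiuSignElement K (D.type t100) D.e₁₀₀ := by
  rw [he]
  exact isLiuSignElement_mul_of_sign (T5CubeTypes.isCMType_cubeType hfr t111) h₁₁₁
    (star_u_mul_one_sub hm.1) (mul_ne_zero (ne_zero_of_magSpec hm) (one_sub_ne_zero_of_magSpec hm))
    (pos_re_u_mul_one_sub_iff hfr hm)

/-- LEMMA N.2 WITH THE ISOMETRY WRITTEN DOWN: every datum with a CM frame, a μ-admissible `e₁₁₁`,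
a similitude scalar of the magnitudes `MagSpec` and `e₁₀₀ = u(1 − u) e₁₁₁` satisfies `Adm` — with
NO display (`isIsometric_of_explicit` in place of the classification). -/
theorem adm_of_explicit {F : FaceSetting K} {P : NDatum F} {𝒟 : N3Datum} (D : N2Datum F P 𝒟)
    (hfr : IsCMFrame D.τ) (h₁₁₁ : IsLiuSignElement K (D.type t111) D.e₁₁₁)
    (hm : MagSpec D.τ D.u) (he : D.e₁₀₀ = D.u * (1 - D.u) * D.e₁₁₁) : D.Adm :=
  ⟨N2Main.muAdmissible_of D hfr h₁₁₁ (isLiuSignElement_e₁₀₀_of_explicit D hfr h₁₁₁ hm he)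
      (uSpec_of_magSpec D hfr hm),
    isIsometric_of_explicit D hm.1 (ne_zero_of_magSpec hm) he, N2Main.hChi D⟩

/-! ### The toy datum -/

/-- The similitude scalar of the toy: the `u` of `exists_magSpec`. -/
noncomputable def uOf {τ : Fin 3 → (K →+* ℂ)} (hfr : IsCMFrame τ) : K :=
  Classical.choose (exists_magSpec hfr)

/-- `uOf` has the magnitudes. -/
theorem magSpec_uOf {τ : Fin 3 → (K →+* ℂ)} (hfr : IsCMFrame τ) : MagSpec τ (uOf hfr) :=
  Classical.choose_spec (exists_magSpec hfr)

/-- The generating sign element of the toy: the `e₁` of p3's `exists_signElements_of_isCMFrame`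
(p402183: a Liu sign element for the vertex type `111`, by weak approximation). -/
noncomputable def e111Of {τ : Fin 3 → (K →+* ℂ)} (hfr : IsCMFrame τ) : K :=
  Classical.choose (T5N2DatumExistence.exists_signElements_of_isCMFrame hfr)

/-- `e111Of` is μ-admissible for the vertex type `111`. -/
theorem isLiuSignElement_e111Of {τ : Fin 3 → (K →+* ℂ)} (hfr : IsCMFrame τ) :
    IsLiuSignElement K (T5CubeTypes.cubeType τ t111) (e111Of hfr) :=
  (Classical.choose_spec
    (Classical.choose_spec (T5N2DatumExistence.exists_signElements_of_isCMFrame hfr))).1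

/-- THE TOY DATUM WITH AN EXPLICIT ISOMETRY, on any CM frame `τ` of `K`: `e₁₁₁ := e111Of`,
`u := uOf`, `e₁₀₀ := u (1 − u) e₁₁₁`, `Char := Unit`, admissible sets `Set.univ`. -/
noncomputable def toyIso (F : FaceSetting K) (P : NDatum F) (𝒟 : N3Datum)
    {τ : Fin 3 → (K →+* ℂ)} (hfr : IsCMFrame τ) : N2Datum F P 𝒟 :=
  N2Datum.mk τ (e111Of hfr) (uOf hfr * (1 - uOf hfr) * e111Of hfr) (uOf hfr) Unit () ()
    Set.univ Set.univ Set.univ Set.univ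

/-- (d) WITH NO HYPOTHESIS: the toy datum satisfies `Adm` — μ-admissibility, the isometry
`W_B ≅ W_A` (written down), and (H_χ). -/
theorem toyIso_adm (F : FaceSetting K) (P : NDatum F) (𝒟 : N3Datum)
    {τ : Fin 3 → (K →+* ℂ)} (hfr : IsCMFrame τ) : (toyIso F P 𝒟 hfr).Adm :=
  adm_of_explicit _ hfr (isLiuSignElement_e111Of hfr) (magSpec_uOf hfr) rfl

/-- Every Schwartz quadruple is admissible data on the toy. -/
theorem toyIso_admData (F : FaceSetting K) (P : NDatum F) (𝒟 : N3Datum)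
    {τ : Fin 3 → (K →+* ℂ)} (hfr : IsCMFrame τ) (φ : 𝒟.A.Sa × 𝒟.A.Sb × 𝒟.B.Sa × 𝒟.B.Sb) :
    (toyIso F P 𝒟 hfr).AdmData φ :=
  ⟨Set.mem_univ _, Set.mem_univ _, Set.mem_univ _, Set.mem_univ _⟩

/-- The toy's isometry, explicitly: `gEquiv (uOf hfr)`. -/
theorem toyIso_formB_gEquiv (F : FaceSetting K) (P : NDatum F) (𝒟 : N3Datum)
    {τ : Fin 3 → (K →+* ℂ)} (hfr : IsCMFrame τ) (v w : K × K) :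
    (toyIso F P 𝒟 hfr).formB (gEquiv (uOf hfr) v) (gEquiv (uOf hfr) w) =
      (toyIso F P 𝒟 hfr).formA v w :=
  formB_gEquiv _ (magSpec_uOf hfr).1 (ne_zero_of_magSpec (magSpec_uOf hfr)) rfl v w

/-! ### On the M2 carrier: `AdmDatum` of `NAut2.ofNAut M₁ (toyIso …)` with no hypothesis -/

/-- THE N2 BLOCK OF THE v2 LINE ON ANY v1 CARRIER: adjoining the toy datum to a v1 carrier `M₁`
(the lead's `NAut2.ofNAut`) gives a v2 carrier whose `AdmDatum` (the binder `hN2` of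
`periodInputN_of_mains₂`) holds with NO hypothesis. -/
theorem ofNAut_toyIso_admDatum {F : FaceSetting K} {P : NDatum F} (M₁ : NAut F P)
    {τ : Fin 3 → (K →+* ℂ)} (hfr : IsCMFrame τ) :
    (NAut2.ofNAut M₁ (toyIso F P M₁.d3 hfr)).AdmDatum :=
  toyIso_adm F P M₁.d3 hfr

/-- `N2_main` WITHOUT THE DISPLAY (the M2 wrapper of T6N2Contract for datums of the explicit shape):
on the M2 carrier, if the N2 datum's frame is a CM frame, `e₁₁₁` is μ-admissible for `111`, `u` has
the magnitudes `MagSpec` and `e₁₀₀ = u (1 − u) e₁₁₁`, then `M.AdmDatum` — the binder `hN2` of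
`periodInputN_of_mains₂` with NO display: the record's datum is a CONSTRUCTION (TIER5 (N2-b): «THIS
is the datum N0 states once and N1–N5 instantiate»; it asks of `e₁₀₀` only μ-admissibility for `100`
and of `u` only the signs `(+, −, +)`, both met here), so choosing it in this shape removes N2's
display from the M2 line's residual census. -/
theorem N2_main_explicit {F : FaceSetting K} {P : NDatum F} (M : NAut2 F P)
    (hfr : IsCMFrame M.d2.τ) (h₁₁₁ : IsLiuSignElement K (M.d2.type t111) M.d2.e₁₁₁)
    (hm : MagSpec M.d2.τ M.d2.u) (he : M.d2.e₁₀₀ = M.d2.u * (1 - M.d2.u) * M.d2.e₁₁₁) :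
    M.AdmDatum :=
  adm_of_explicit M.d2 hfr h₁₁₁ hm he

/-! ### Degree-6 CM fields and `ℚ(ζ₇)` -/

/-- A CM frame on a degree-6 CM field (p3's `exists_muAdmissible_frame`, p402183). -/
noncomputable def frameOf (h6 : Module.finrank ℚ K = 6) : Fin 3 → (K →+* ℂ) :=
  Classical.choose (T5N2DatumExistence.exists_muAdmissible_frame (K := K) h6)

/-- `frameOf` is a CM frame. -/
theorem isCMFrame_frameOf (h6 : Module.finrank ℚ K = 6) : IsCMFrame (frameOf h6) := by
  obtain ⟨_, _, _, h, -, -, -, -, -, -⟩ :=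
    Classical.choose_spec (T5N2DatumExistence.exists_muAdmissible_frame (K := K) h6)
  exact h

/-- The toy datum with an explicit isometry on any degree-6 CM field. -/
noncomputable def toyIso6 (h6 : Module.finrank ℚ K = 6) (F : FaceSetting K) (P : NDatum F)
    (𝒟 : N3Datum) : N2Datum F P 𝒟 :=
  toyIso F P 𝒟 (isCMFrame_frameOf h6)

/-- `Adm` with no hypothesis on any degree-6 CM field. -/
theorem toyIso6_adm (h6 : Module.finrank ℚ K = 6) (F : FaceSetting K) (P : NDatum F)
    (𝒟 : N3Datum) : (toyIso6 h6 F P 𝒟).Adm :=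
  toyIso_adm F P 𝒟 (isCMFrame_frameOf h6)

/-- The toy datum on ANY face setting: the face setting's own `deg6` field supplies the frame. -/
noncomputable def toyIsoF (F : FaceSetting K) (P : NDatum F) (𝒟 : N3Datum) : N2Datum F P 𝒟 :=
  toyIso6 F.deg6 F P 𝒟

/-- `Adm` on the face setting's toy datum, no binder. -/
theorem toyIsoF_adm (F : FaceSetting K) (P : NDatum F) (𝒟 : N3Datum) : (toyIsoF F P 𝒟).Adm :=
  toyIso6_adm F.deg6 F P 𝒟

/-- (c) on any face setting: the datum type is inhabited, no binder. -/
theorem nonempty_n2Datum (F : FaceSetting K) (P : NDatum F) (𝒟 : N3Datum) :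
    Nonempty (N2Datum F P 𝒟) :=
  ⟨toyIsoF F P 𝒟⟩

/-- THE N2 BLOCK OF THE v2 LINE ON ANY v1 CARRIER, NO BINDER AT ALL: `NAut2.ofNAut M₁ (toyIsoF …)`
has `AdmDatum`. -/
theorem ofNAut_toyIsoF_admDatum {F : FaceSetting K} {P : NDatum F} (M₁ : NAut F P) :
    (NAut2.ofNAut M₁ (toyIsoF F P M₁.d3)).AdmDatum :=
  toyIsoF_adm F P M₁.d3

/-- The toy datum with an explicit isometry on `K7 = ℚ(ζ₇)` (p1's `CyclotomicSeven.finrank_K7`). -/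
noncomputable def toyIsoK7 (F : FaceSetting CyclotomicSeven.K7) (P : NDatum F) (𝒟 : N3Datum) :
    N2Datum F P 𝒟 :=
  toyIso6 CyclotomicSeven.finrank_K7 F P 𝒟

/-- `Adm` with no hypothesis on `ℚ(ζ₇)`. -/
theorem toyIsoK7_adm (F : FaceSetting CyclotomicSeven.K7) (P : NDatum F) (𝒟 : N3Datum) :
    (toyIsoK7 F P 𝒟).Adm :=
  toyIso6_adm CyclotomicSeven.finrank_K7 F P 𝒟

end Summit.Ventures.HodgeRepro2.T6.N2ToyIso
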